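import Summits.BirchSwinnertonDyer.BirchSwinnertonDyer.Theorems.ByReductionTypeAtTwoKatoHalfPinch
import Summits.BirchSwinnertonDyer.Rank1Residual.X5.KatoOrdTwoTowerGapIff
import Summits.BirchSwinnertonDyer.Rank1Residual.X5.TwoAdicTargetsClosedForm
import HarnessLib

/-!
# The TOWER door at a good ordinary `2`: `μ(X) = 0` (tower-gap certificate) + `λ(X) ≥ λ_an` ⇒ the
# `2`-adic main conjecture, both halves and `BSD(E,2)` — for ANY residual image, in particular on the
# 440 `E[2]`-irreducible open classes (route ByReductionTypeAtTwo, crux child `OrdKatoHalfAtTwo`,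
# item stmt-BirchSwinnertonDyer-19150; seat bsd-2adic-ord-2)

HONEST FRAMING (cell `bsd-2adic`, run/shared/lean/pub/bsd-2adic/, HUMAN RULINGS D-0036/D-0074): THEOREMS
ONLY; nothing asserted; no definition; no named fact; closes nothing. Off the 83-class α-go habitat
(Greenberg Prop. 5.14) no PRINTED statement gives `μ(X(E/ℚ_∞)) = 0` at `2`; on the 440 open classes
with `E[2]` irreducible it is Greenberg's Conjecture 1.11 at `p = 2`. This file does NOT prove it. It
records the exact CERTIFICATE SHAPE under which the cell's pinch closes such a class WITHOUT any
Eisenstein-side input and WITHOUT `BSD(E,2)`: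

* §1 (pure `Λ`-algebra, any `p`): `L ∈ (f)`, `f, L ≠ 0`, `μ(L) = μ(f) = 0`, `λ(L) ≤ λ(f)` ⇒
  `(L) = (f)` and `λ(L) = λ(f)` (`λ` is monotone under divisibility; then the landed
  `X1.MuLambda.span_eq_span_iff_mu_lam`).
* §2 (a cyclotomic datum of a good-ordinary-at-`2` curve, ANY analytic rank, ANY residual image):
  PRINT Kato 17.4 (1)(2) at `2` (`h17`) + the certificates {`TowerGapAtTwo W` (⟺ `X` torsion ∧
  `μ(X) = 0`, `KatoOrdTwoTowerGapIff`), `AnalyticMuLE W 2 0` (`μ_an = 0`), `AnalyticLambdaEq W 2 n`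
  (`λ_an = n`), `n ≤ λ(X)` for every cyclotomic datum (`hlamge`)} ⇒ `char_Λ X = (L₀)`, `λ(X) = n`.
  Mechanism: `μ(X) = 0` upgrades Kato's rational divisibility to `L₀ ∈ char X = (f_X)`
  (`MuZeroUpgrade.charIdeal_dvd_of_kato_allPrimes_of_mu_eq_zero`), so `λ(f_X) ≤ λ(L₀) = n ≤ λ(X) =
  λ(f_X)` and §1 applies. The opposite inequality `λ(X) ≤ λ_an` is thus FREE from Kato; only
  `λ(X) ≥ λ_an` is a certificate.
* §3 consumers: `MazurMainConjecture W 2` (with Néron integrality `hper₀` to produce `L₀`), hence (rank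
  `0`, + modularity, GZK, Greenberg 4.1@2) the Kato half, the Eisenstein half and `BSDp W 2`.

WHERE THE TWO CERTIFICATES COME FROM (not formalised here; the typed inputs a successor must land as
named facts, Greenberg LNM 1716 §§3–4 read at `p = 2`): with `a_j := dim_{𝔽₂} X/(2, T^j)X`,
`TowerGapAtTwo W` is `∃ m k, a_{m+k} < k + a_m`, and when `X` has no non-zero finite submodule
(Greenberg Prop. 4.14/4.15: `E(ℚ_∞)[2] = 0`, automatic for irreducible `E[2]`) `a_j ≤ dim X/2X = λ(X)`,
so `a_j ≥ λ_an` for one `j` gives `hlamge`. By inflation–restriction (`E[2](ℚ_∞) = 0`) `a_{2^m}` is the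
`𝔽₂`-dimension of a generalised `2`-Selmer group of `E` over the layer `ℚ_m` (`ℚ`, `ℚ(√2)`, `ℚ(ζ₁₆)⁺`,
…) with the local conditions induced from `ℚ_∞` — a `2`-DESCENT quantity, exact, no `Ш`-order needed.
For a cyclic `X ≅ Λ/(f_X)` the certificate (m,k) = (1,1) [resp. (2,2)] succeeds iff `λ ≤ 1` [resp.
`λ ≤ 3`], i.e. descents over `ℚ` and `ℚ(√2)` [resp. also `ℚ(ζ₁₆)⁺`] suffice exactly on the classes
with `λ_an ≤ 1` [resp. `≤ 3`] (seat census kit j248690 sizes this habitat among the 528 open classes).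

References: K. Kato, Astérisque 295 (2004), Thm. 17.4; R. Greenberg, LNM 1716 (1999), Thm. 4.1,
Props. 4.14–4.15, §3; R. Greenberg, V. Vatsal, Invent. Math. 142 (2000), p. 4; L. Washington,
*Introduction to Cyclotomic Fields*, §13.2; R. L. Miller, LMS J. Comput. Math. 14 (2011), Def. 1.1.
-/

set_option autoImplicit false

noncomputable section

open scoped Classical MatrixGroups ModularForm

open CongruenceSubgroup WeierstrassCurve Literature.NumberTheory.EllipticCurves
  Literature.NumberTheory.EllipticCurves.ModularForms Literature.NumberTheory.EllipticCurves.Rank1Residual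
  Literature.NumberTheory.EllipticCurves.Rank1Residual.Typed
  Summit.BirchSwinnertonDyer.Rank1Residual.X1.MuLambda
  Summit.BirchSwinnertonDyer.Rank1Residual.X1.MuPart
  Summit.BirchSwinnertonDyer.Rank1Residual.X1.ParitySqueeze
  Summit.BirchSwinnertonDyer.BirchSwinnertonDyer.Theorems.Rank1ResidualX1Defs
  Summit.BirchSwinnertonDyer.Rank1Residual.X5 Summit.BirchSwinnertonDyer.Rank1Residual.X5.O1

namespace Summit.BirchSwinnertonDyer.BirchSwinnertonDyer.Theorems.KatoHalfPinch

/-! ## §1 The `μ = 0` + `λ`-lower-bound pinch (pure `Λ`-algebra, any `p`) -/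

variable {p : ℕ} [Fact p.Prime]

/-- **The `μ = 0` + `λ`-lower-bound pinch.** In `Λ = ℤ_p⟦T⟧`: if `L ∈ (f)` with `f, L ≠ 0`,
`μ(L) = 0`, `μ(f) = 0` and `λ(L) ≤ λ(f)`, then `(L) = (f)` and `λ(L) = λ(f)`: writing `L = f·b`,
`λ(L) = λ(f) + λ(b) ≥ λ(f)` forces `λ(L) = λ(f)`, and with `μ(L) = μ(f)` the landed
`X1.MuLambda.span_eq_span_iff_mu_lam` gives `b ∈ Λˣ`.
[cite: GreenbergVatsal2000, p. 4 (after Thm. (1.2))] [cite: Washington1997, §7.1] -/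
theorem span_eq_span_of_mem_span_of_mu_eq_zero_of_lam_le {f L : IwasawaAlgebra p}
    (hmem : L ∈ Ideal.span ({f} : Set (IwasawaAlgebra p))) (hf : f ≠ 0) (hL : L ≠ 0)
    (hμL : mu L = 0) (hμf : mu f = 0) (hlam : lam L ≤ lam f) :
    Ideal.span ({L} : Set (IwasawaAlgebra p)) = Ideal.span {f} ∧ lam L = lam f := by
  obtain ⟨b, hb⟩ := Ideal.mem_span_singleton'.mp hmem
  have hfac : L = f * b := by rw [mul_comm, hb]
  have hb0 : b ≠ 0 := by rintro rfl; exact hL (by rw [hfac, mul_zero])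
  have hge : lam f ≤ lam L := by rw [hfac]; exact lam_le_lam_mul hf hb0
  have hlam' : lam L = lam f := le_antisymm hlam hge
  exact ⟨(span_eq_span_iff_mu_lam hf hL hfac).mpr ⟨hμL.trans hμf.symm, hlam'⟩, hlam'⟩

/-! ## §2 The TOWER door at a datum: `char_Λ X = (L₀)` from Kato 17.4 (1)(2)@2 + {`μ(X) = 0`, `μ_an = 0`,
`λ_an = n ≤ λ(X)`} -/

section Curve

variable (W : WeierstrassCurve ℚ) [W.IsElliptic] [W.IsGloballyMinimal]

/-- **The `2`-adic main conjecture at a cyclotomic datum from the TOWER certificates — any analytic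
rank, any residual image.** `W` globally minimal, good ordinary at `2`; PUBLISHED input Kato 17.4
(1)(2) at `2` (`h17`); certificates: `TowerGapAtTwo W` (⟺ `X(E/ℚ_∞)` torsion ∧ `μ = 0` for every
cyclotomic datum; `KatoOrdTwoTowerGapIff`), `AnalyticMuLE W 2 0` (`μ_an = 0`), `AnalyticLambdaEq W 2 n`
(`λ_an = n`), and `n ≤ λ(X)` for every cyclotomic datum (`hlamge`; e.g. from `dim X/(2,T^j)X ≥ n` and
no finite submodule). Then for every `L₀ ∈ Λ` with `ι L₀ = ϖ·L₂(f,α)`: `X` torsion, `μ(X) = 0`,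
`λ(X) = n` and `char_Λ X = (L₀)`. NO `BSD(E,2)`, NO Eisenstein input, NO rational-`2`-torsion structure.
[cite: Kato2004Asterisque, Thm. 17.4 (1)(2) (p. 273)] [cite: GreenbergVatsal2000, p. 4 (after Thm. (1.2))]
[cite: Washington1997, §13.2] -/
theorem charIdeal_eq_span_of_towerGap_of_lambda_le
    (h17 : ∀ [NeZero (W.conductorNorm ℤ)] (f : CuspForm (Gamma0 (W.conductorNorm ℤ)) 2),
      kato_divisibility_allPrimes W 2 (f := f))
    (hgo : GoodOrd W 2) (hgap : TowerGapAtTwo W) {n : ℕ} (hlan : AnalyticLambdaEq W 2 n)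
    (hμan : AnalyticMuLE W 2 0)
    (hlamge : ∀ (κ : ZpExtension ℚ 2) (γ : Field.absoluteGaloisGroup ℚ), κ.IsCyclotomic →
      κ.IsTopGenerator γ → IsCyclotomicVariable 2 γ → ∀ D : W.SelmerDualData κ γ, n ≤ D.lambda)
    {κ : ZpExtension ℚ 2} {γ : Field.absoluteGaloisGroup ℚ} (hκ : κ.IsCyclotomic)
    (hγ : κ.IsTopGenerator γ) (hγ' : IsCyclotomicVariable 2 γ) [NeZero (W.conductorNorm ℤ)]
    {f : CuspForm (Gamma0 (W.conductorNorm ℤ)) 2} (hf : IsNewformOf W f) {ϖ : ℚ}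
    (hϖ : (ϖ : ℝ) * W.realPeriodRat = plusPeriod f) (D : W.SelmerDualData κ γ)
    {L₀ : IwasawaAlgebra 2} (hL₀ : iwasawaToPowerSeries 2 L₀ =
      PowerSeries.C (ϖ : ℚ_[2]) * padicLFunction f (unitRoot W 2 : ℚ_[2])) :
    D.IsTorsion ∧ D.mu = 0 ∧ D.lambda = n ∧ D.charIdeal = Ideal.span {L₀} := by
  have hord : IsOrdinaryAt W 2 := hgo
  haveI : Module.Finite (IwasawaAlgebra 2) D.X := D.module_finite_holds hγ
  -- the tower-gap certificate: `X` torsion, `μ(X) = 0`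
  obtain ⟨hX, hμ⟩ := isTorsion_and_mu_eq_zero_of_towerGapAtTwo W hgap hκ hγ hγ' D
  -- the certificate `μ(L₀) = 0`, hence `L₀ ≠ 0`
  obtain ⟨k, hk⟩ := hμan f hf ϖ hϖ
  rw [← hL₀] at hk
  have hμL₀ : mu L₀ = 0 := Nat.le_zero.mp (mu_le_of_lt_norm_coeff hk)
  have hL₀0 : L₀ ≠ 0 := by
    rintro rfl
    rw [map_zero, map_zero, norm_zero] at hk
    exact not_le.mpr hk (by positivity)
  -- Kato 17.4 (1)(2) at `2` + `μ(X) = 0`: `L₀ ∈ char X`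
  obtain ⟨-, hL₀mem⟩ := MuZeroUpgrade.charIdeal_dvd_of_kato_allPrimes_of_mu_eq_zero W 2
    (h17 f) hκ hγ hγ' hord hf D hμ hL₀
  -- a generator `f_X` of `char X`
  haveI : (Module.charIdeal (IwasawaAlgebra 2) D.X).IsPrincipal := charIdeal_isPrincipal_holds 2 D.X
  obtain ⟨fX, hfX⟩ := Submodule.IsPrincipal.principal (Module.charIdeal (IwasawaAlgebra 2) D.X)
  have hchar : D.charIdeal = Ideal.span {fX} := hfX
  have hfX0 : fX ≠ 0 := by
    intro h0
    refine Module.charIdeal_ne_bot (IwasawaAlgebra 2) D.X ?_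
    change D.charIdeal = ⊥
    rw [hchar, h0]
    exact Ideal.span_singleton_eq_bot.mpr rfl
  -- `λ`/`μ` bookkeeping: `λ(L₀) = n ≤ λ(X) = λ(f_X)`, `μ(f_X) = μ(X) = 0`
  have hlamfX : lam fX = D.lambda := lam_generator_eq_lambdaInvariant D.X hX hfX0 hchar
  have hlan' : lam L₀ = n := hlan f hf ϖ hϖ L₀ hL₀
  have hle : lam L₀ ≤ lam fX := by rw [hlan', hlamfX]; exact hlamge κ γ hκ hγ hγ' D
  have hμfX : mu fX = 0 := by
    rw [mu_generator_eq_muInvariant D.X hX hfX0 hchar]; exact hμ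
  -- the pinch `(L₀) = (f_X)` and `λ(X) = n`
  rw [hchar] at hL₀mem
  obtain ⟨hspan, hlameq⟩ :=
    span_eq_span_of_mem_span_of_mu_eq_zero_of_lam_le hL₀mem hfX0 hL₀0 hμL₀ hμfX hle
  refine ⟨hX, hμ, ?_, by rw [hchar, hspan]⟩
  rw [← hlamfX, ← hlameq, hlan']

/-! ## §3 Consumers: `MazurMainConjecture W 2`, both halves, `BSD(E,2)` at analytic rank `0` -/

/-- **Door (TOWER): `MazurMainConjecture W 2` at a good ordinary `2` from PRINT Kato 17.4 (1)(2)@2 +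
certificates {Néron integrality `hper₀`, `TowerGapAtTwo W` (`μ(X) = 0`), `μ_an = 0`, `λ_an = n`,
`n ≤ λ(X)`}** — any analytic rank, any residual image; no `BSD(E,2)`, no Eisenstein input, no
rational `2`-torsion. [cite: Kato2004Asterisque, Thm. 17.4 (1)(2) (p. 273)]
[cite: GreenbergVatsal2000, p. 4 (after Thm. (1.2))] -/
theorem mazurMainConjecture_two_of_towerGap_of_lambda_le
    (h17 : ∀ [NeZero (W.conductorNorm ℤ)] (f : CuspForm (Gamma0 (W.conductorNorm ℤ)) 2),
      kato_divisibility_allPrimes W 2 (f := f))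
    (hper₀ : ∀ [NeZero (W.conductorNorm ℤ)] (f : CuspForm (Gamma0 (W.conductorNorm ℤ)) 2),
      IsNewformOf W f → ∀ ϖ : ℚ, (ϖ : ℝ) * W.realPeriodRat = plusPeriod f → 0 ≤ padicValRat 2 ϖ)
    (hgo : GoodOrd W 2) (hgap : TowerGapAtTwo W) {n : ℕ} (hlan : AnalyticLambdaEq W 2 n)
    (hμan : AnalyticMuLE W 2 0)
    (hlamge : ∀ (κ : ZpExtension ℚ 2) (γ : Field.absoluteGaloisGroup ℚ), κ.IsCyclotomic →
      κ.IsTopGenerator γ → IsCyclotomicVariable 2 γ → ∀ D : W.SelmerDualData κ γ, n ≤ D.lambda) :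
    MazurMainConjecture W 2 := by
  intro κ γ hκ hγ hγ' _ f hf ϖ hϖ D
  have hord : IsOrdinaryAt W 2 := hgo
  obtain ⟨L₀, hL₀⟩ :=
    exists_integral_mul_padicLFunction_two_of_padicValRat_nonneg W hord hf (hper₀ f hf ϖ hϖ)
  obtain ⟨hX, -, -, hchar⟩ := charIdeal_eq_span_of_towerGap_of_lambda_le W h17 hgo hgap hlan hμan
    hlamge hκ hγ hγ' hf hϖ D hL₀
  exact ⟨hX, L₀, hchar, hL₀⟩

/-- **The Kato–Néron half (the item `OrdKatoHalfAtTwo` AT `W`) from the tower certificates.**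
[cite: Kato2004Asterisque, Thm. 17.4 (1)(2) (p. 273)] -/
theorem katoHalfAt_two_of_towerGap_of_lambda_le
    (h17 : ∀ [NeZero (W.conductorNorm ℤ)] (f : CuspForm (Gamma0 (W.conductorNorm ℤ)) 2),
      kato_divisibility_allPrimes W 2 (f := f))
    (hper₀ : ∀ [NeZero (W.conductorNorm ℤ)] (f : CuspForm (Gamma0 (W.conductorNorm ℤ)) 2),
      IsNewformOf W f → ∀ ϖ : ℚ, (ϖ : ℝ) * W.realPeriodRat = plusPeriod f → 0 ≤ padicValRat 2 ϖ)
    (hgo : GoodOrd W 2) (hgap : TowerGapAtTwo W) {n : ℕ} (hlan : AnalyticLambdaEq W 2 n)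
    (hμan : AnalyticMuLE W 2 0)
    (hlamge : ∀ (κ : ZpExtension ℚ 2) (γ : Field.absoluteGaloisGroup ℚ), κ.IsCyclotomic →
      κ.IsTopGenerator γ → IsCyclotomicVariable 2 γ → ∀ D : W.SelmerDualData κ γ, n ≤ D.lambda) :
    MainConjectureLowerDivisibilityAtTwoOrd W :=
  mainConjectureLowerDivisibilityAtTwoOrd_of_mazurMainConjecture W
    (fun _ => mazurMainConjecture_two_of_towerGap_of_lambda_le W h17 hper₀ hgo hgap hlan hμan hlamge)

/-- **The Eisenstein half from the tower certificates.** [cite: Kato2004Asterisque, Thm. 17.4 (1)(2) (p. 273)]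
[cite: SkinnerUrban2014, Conj. 3.6.8 (p. 45) (shape)] -/
theorem eisensteinAt_two_of_towerGap_of_lambda_le
    (h17 : ∀ [NeZero (W.conductorNorm ℤ)] (f : CuspForm (Gamma0 (W.conductorNorm ℤ)) 2),
      kato_divisibility_allPrimes W 2 (f := f))
    (hper₀ : ∀ [NeZero (W.conductorNorm ℤ)] (f : CuspForm (Gamma0 (W.conductorNorm ℤ)) 2),
      IsNewformOf W f → ∀ ϖ : ℚ, (ϖ : ℝ) * W.realPeriodRat = plusPeriod f → 0 ≤ padicValRat 2 ϖ)
    (hgo : GoodOrd W 2) (hgap : TowerGapAtTwo W) {n : ℕ} (hlan : AnalyticLambdaEq W 2 n)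
    (hμan : AnalyticMuLE W 2 0)
    (hlamge : ∀ (κ : ZpExtension ℚ 2) (γ : Field.absoluteGaloisGroup ℚ), κ.IsCyclotomic →
      κ.IsTopGenerator γ → IsCyclotomicVariable 2 γ → ∀ D : W.SelmerDualData κ γ, n ≤ D.lambda) :
    MainConjectureEisensteinDivisibilityAtTwo W :=
  mainConjectureEisensteinDivisibilityAtTwo_of_mazurMainConjecture W
    (fun _ => mazurMainConjecture_two_of_towerGap_of_lambda_le W h17 hper₀ hgo hgap hlan hμan hlamge)

/-- **Door (TOWER) for `BSD(E,2)` at analytic rank `0`:** PRINT {modularity, GZK, Kato 17.4 (1)(2)@2,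
Greenberg Thm. 4.1@2 (`hEC`, δ = 0)} + certificates {`hper₀`, `TowerGapAtTwo W`, `μ_an = 0`, `λ_an = n`,
`n ≤ λ(X)`} ⇒ `BSDp W 2` (the two halves via the landed doors
`missingUpperBoundAt_two_of_mainConjectureLowerDivisibilityAtTwoOrd_of_kato` /
`missingLowerBoundAt_two_of_eisenstein_of_kato`, then Miller's glue). Compare the landed
`O1.bsdp_two_of_towerGap_of_lowerBound`, whose `hlow` (a lower bound on `#Ш[2^∞]`) is replaced here by
the tower-side `λ`-certificate `n ≤ λ(X)`. [cite: GreenbergLNM1716, Thm. 4.1 (p. 102)]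
[cite: Kato2004Asterisque, Thm. 17.4 (1)(2) (p. 273)] [cite: Miller2011LMS, Def. 1.1] -/
theorem bsdp_two_of_towerGap_of_lambda_le (hmod : nonempty_modularParametrizationData)
    (hGZK : rank_eq_analyticRank_of_analyticRank_le_one)
    (h17 : ∀ [NeZero (W.conductorNorm ℤ)] (f : CuspForm (Gamma0 (W.conductorNorm ℤ)) 2),
      kato_divisibility_allPrimes W 2 (f := f))
    (hEC : TwoAdicEulerCharRankZero W 0)
    (hper₀ : ∀ [NeZero (W.conductorNorm ℤ)] (f : CuspForm (Gamma0 (W.conductorNorm ℤ)) 2),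
      IsNewformOf W f → ∀ ϖ : ℚ, (ϖ : ℝ) * W.realPeriodRat = plusPeriod f → 0 ≤ padicValRat 2 ϖ)
    (hgo : GoodOrd W 2) (hr : W.analyticRank = 0) (hgap : TowerGapAtTwo W) {n : ℕ}
    (hlan : AnalyticLambdaEq W 2 n) (hμan : AnalyticMuLE W 2 0)
    (hlamge : ∀ (κ : ZpExtension ℚ 2) (γ : Field.absoluteGaloisGroup ℚ), κ.IsCyclotomic →
      κ.IsTopGenerator γ → IsCyclotomicVariable 2 γ → ∀ D : W.SelmerDualData κ γ, n ≤ D.lambda) :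
    BSDp W 2 := by
  have hU : MissingUpperBoundAt W 2 :=
    missingUpperBoundAt_two_of_mainConjectureLowerDivisibilityAtTwoOrd_of_kato W hEC hmod hGZK h17 hr hgo
      (katoHalfAt_two_of_towerGap_of_lambda_le W h17 hper₀ hgo hgap hlan hμan hlamge)
  have hL : MissingLowerBoundAt W 2 :=
    missingLowerBoundAt_two_of_eisenstein_of_kato W hEC hmod hGZK h17 hr hgo
      (eisensteinAt_two_of_towerGap_of_lambda_le W h17 hper₀ hgo hgap hlan hμan hlamge)
  exact bsdp_of_missingPPartAt W 2 hGZK (by omega) (missingPPartAt_of_lower_of_upper W 2 hL hU)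

end Curve

end Summit.BirchSwinnertonDyer.BirchSwinnertonDyer.Theorems.KatoHalfPinch

end
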